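import Summits.AnomalousDissipation.AnomalousDissipation.Theorems.SolenoidalFractalHomogenisationLagrangianStepVmodHigh
import Summits.AnomalousDissipation.AnomalousDissipation.Theorems.SolenoidalFractalHomogenisationLagrangianStepVmodSlowTestTools
import HarnessLib

/-!
# K1L_D (stmt-AnomalousDissipation-27980): (V_mod) flat stage — HIGH CLASSES, GENERAL DATA: the W7 clause `HighLabelDecayW` read at the
# propagator level on an ARBITRARY divergence-free `L²` datum without low labels (rows «H / high / τ ≥ P» of the certifier's table for the
# blocks (fs), (sf), (ff), (hh); tool T-H)
(helper; `--supports 27980 --as helper`; prover ad-k1loc-p3 g10; the general-data twin of `VmodGen.norm_apply_le_of_highLabelDecay`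
(`…VmodHigh`, pair data only).)

`HighLabelDecayW W M hM lo hi Λ β νh Kb CK cK` speaks about `IsDatum`s (`H¹`, zero mean, divergence-free).  A general `f ∈ divFreeL2` is only
`L²`, so we truncate: `F_N := fourierTruncate N ⇑f` is a smooth divergence-free trigonometric polynomial with the Fourier coefficients of `f`
on `freqBall N` and `0` elsewhere; if `f` has no coefficient at any `k' = ℓ' + n•z` with `‖latticeVec ℓ'‖ < L`, neither has `F_N` (and in
particular `F_N` has zero mean).  The bridge-with-energy `exists_sol_modeRep_energy` (window start at carrier phase 0) and the clause give
`‖U s t [F_N]‖ ≤ √CK·exp(−cK·ν·(t−s))·‖[F_N]‖ ≤ √CK·exp(−cK·ν·(t−s))·‖f‖` for every `N`, and `[F_N] → f` in `V2` (Parseval tail), whence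

  `‖U s t f‖ ≤ √CK · exp(−cK·ν·(t − s)) · ‖f‖`   (`norm_apply_le_of_highLabelDecay_general`).

`sorry`-free; NOT a proof of any block, of the stub, of K1L_D or of AD; rung F-D1.A0.
-/

set_option linter.dupNamespace false

noncomputable section

namespace Summit.AnomalousDissipation.AnomalousDissipation.Theorems.SolenoidalFractalHomogenisation.LagrangianStep.VmodGen

open Set MeasureTheory Complex UnitAddTorus Filter
open scoped InnerProductSpace ENNReal Topology
open Literature.Analysis Literature.Analysis.FunctionSpaces Literature.Analysis.FunctionSpaces.Torus
open Literature.Analysis.FluidPDE Literature.Analysis.FluidPDE.Torus Literature.Analysis.FluidPDE.LatticeShear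
open Summit.AnomalousDissipation.AnomalousDissipation.Theorems.SolenoidalFractalHomogenisation.LagrangianStep.CellChain (le_on_Icc_of_ae_le)
open Summit.AnomalousDissipation.AnomalousDissipation.Theorems.SolenoidalFractalHomogenisation.LagrangianStep.VmodFlat
  (fc fc_sub fc_toLp_fourierTruncate)

variable {k : ℕ}

/-- The `L²` distance from `f` to the class of its `N`-th Fourier truncation is the Parseval tail:
`‖f − [fourierTruncate N ⇑f]‖² = ‖f‖² − Σ_{k ∈ freqBall N} ‖𝓕f(k)‖²`. [folklore] -/
theorem norm_sq_sub_toLp_fourierTruncate (f : V2) (N : ℕ) :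
    ‖f - ((Torus.isSmooth_fourierTruncate N (f : VF)).memLp 2).toLp (Torus.fourierTruncate N (f : VF))‖ ^ 2
      = ‖f‖ ^ 2 - ∑ k' ∈ Torus.freqBall N, ‖fc f k'‖ ^ 2 := by
  classical
  set v : V2 := ((Torus.isSmooth_fourierTruncate N (f : VF)).memLp 2).toLp (Torus.fourierTruncate N (f : VF)) with hv
  have hP : HasSum (fun k' : Fin 3 → ℤ => ‖fc (f - v) k'‖ ^ 2) (‖f - v‖ ^ 2) := hasSum_norm_sq_fcoeff (f - v)
  have hf : HasSum (fun k' : Fin 3 → ℤ => ‖fc f k'‖ ^ 2) (‖f‖ ^ 2) := hasSum_norm_sq_fcoeff f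
  have hb : HasSum (fun k' : Fin 3 → ℤ => if k' ∈ Torus.freqBall N then ‖fc f k'‖ ^ 2 else 0)
      (∑ k' ∈ Torus.freqBall N, ‖fc f k'‖ ^ 2) := by
    have h : HasSum (fun k' : Fin 3 → ℤ => if k' ∈ Torus.freqBall N then ‖fc f k'‖ ^ 2 else 0)
        (∑ k' ∈ Torus.freqBall N, if k' ∈ Torus.freqBall N then ‖fc f k'‖ ^ 2 else 0) :=
      hasSum_sum_of_ne_finset_zero (fun k' hk' => if_neg hk')
    rwa [Finset.sum_congr rfl (fun k' hk' => if_pos hk')] at h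
  have heq : (fun k' : Fin 3 → ℤ => ‖fc (f - v) k'‖ ^ 2)
      = fun k' => ‖fc f k'‖ ^ 2 - (if k' ∈ Torus.freqBall N then ‖fc f k'‖ ^ 2 else 0) := by
    funext k'
    rw [fc_sub, hv, fc_toLp_fourierTruncate]
    split_ifs with hk'
    · rw [sub_self, norm_zero]; ring
    · rw [sub_zero]; ring
  rw [heq] at hP
  exact hP.unique (hf.sub hb)

/-- The truncations converge: `‖f − [fourierTruncate N ⇑f]‖ → 0` as `N → ∞`. [folklore] -/
theorem tendsto_norm_sub_toLp_fourierTruncate (f : V2) :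
    Tendsto (fun N : ℕ => ‖f - ((Torus.isSmooth_fourierTruncate N (f : VF)).memLp 2).toLp (Torus.fourierTruncate N (f : VF))‖)
      atTop (𝓝 0) := by
  classical
  have hf : HasSum (fun k' : Fin 3 → ℤ => ‖fc f k'‖ ^ 2) (‖f‖ ^ 2) := hasSum_norm_sq_fcoeff f
  have hballs : Tendsto (fun N : ℕ => (Torus.freqBall N : Finset (Fin 3 → ℤ))) atTop atTop := by
    refine tendsto_atTop_finset_of_monotone (fun N M h => Torus.freqBall_mono h) fun k' => ?_
    refine ⟨⌈Torus.freqNormSq k'⌉₊, Torus.mem_freqBall.2 ?_⟩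
    calc Torus.freqNormSq k' ≤ (⌈Torus.freqNormSq k'⌉₊ : ℝ) := Nat.le_ceil _
      _ ≤ (⌈Torus.freqNormSq k'⌉₊ : ℝ) ^ 2 := by exact_mod_cast Nat.le_self_pow two_ne_zero _
  have hsq : Tendsto (fun N : ℕ => ‖f - ((Torus.isSmooth_fourierTruncate N (f : VF)).memLp 2).toLp
      (Torus.fourierTruncate N (f : VF))‖ ^ 2) atTop (𝓝 0) := by
    have h1 : Tendsto (fun N : ℕ => ∑ k' ∈ Torus.freqBall N, ‖fc f k'‖ ^ 2) atTop (𝓝 (‖f‖ ^ 2)) := hf.comp hballs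
    have h2 := (tendsto_const_nhds (x := ‖f‖ ^ 2)).sub h1
    rw [sub_self] at h2
    refine h2.congr fun N => ?_
    rw [norm_sq_sub_toLp_fourierTruncate]
  have h3 := (Real.continuous_sqrt.tendsto 0).comp hsq
  rw [Real.sqrt_zero] at h3
  refine h3.congr fun N => ?_
  simp only [Function.comp_apply]
  exact Real.sqrt_sq (norm_nonneg _)

set_option maxHeartbeats 1600000 in
/-- **W7 AT THE PROPAGATOR LEVEL ON A GENERAL DATUM WITHOUT LOW LABELS.**  With `HighLabelDecayW W M hM lo hi Λ β νh Kb CK cK`, `ν < νh`,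
`n·ν ≤ Kb·L`, a window start at carrier phase 0 and ANY weakly divergence-free `f ∈ V2` whose Fourier coefficients vanish at every
`k' = ℓ' + n•z` with `‖latticeVec ℓ'‖ < L` (no low Bloch label): `‖U s t f‖ ≤ √CK·exp(−cK·ν·(t−s))·‖f‖`.  Proof: Fourier truncation
(an admissible `IsDatum` with the same vanishing), the bridge with energy, the clause, and the Parseval tail `N → ∞`.
[cite: BedrossianCotiZelati2017, Thm 1.1] [cite: Temam1984, Ch. III §1 Lemma 1.2] -/
theorem norm_apply_le_of_highLabelDecay_general (W : LatticeWord k) (M : ℝ) (hM : 0 < M) {lo hi Λ β νh Kb CK cK : ℝ}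
    (hH : HighLabelDecayW W M hM lo hi Λ β νh Kb CK cK) (hlo : 0 < lo) (hhi : 0 ≤ hi) (hΛ : 1 ≤ Λ) (hCK : 0 ≤ CK)
    {ν : ℝ} (hν : ν ∈ Set.Ioo 0 νh) {n : ℕ} (hn : 1 ≤ n) {𝔸 : Visc4 (Fin 3)} (hodd : OddSmall 𝔸 (ν * β))
    (hwin : ∃ lam ∈ Set.Icc (1:ℝ) Λ, NearIso 𝔸 (ν * (lo / lam)) (ν * (hi * lam)))
    {Tw : ℝ} {U : ℝ → ℝ → (V2 →L[ℝ] V2)} (hU : IsPropagator Tw (cellField W M hM ν hν.1 n) ((1 / (n:ℝ) ^ 2) • 𝔸) U)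
    {s t : ℝ} (hs : 0 ≤ s) (hst : s ≤ t) (htT : t ≤ Tw) (hsT : s < Tw)
    (hphase : ∀ τ, cellField W M hM ν hν.1 n (s + τ) = cellField W M hM ν hν.1 n τ)
    {L : ℝ} (hL : 0 < L) (hKL : (n : ℝ) * ν ≤ Kb * L)
    (f : V2) (hf : f ∈ divFreeL2 (Fin 3))
    (hfs : ∀ k' : Fin 3 → ℤ, (∃ ℓ' z : Fin 3 → ℤ, ‖Torus.latticeVec ℓ'‖ < L ∧ k' = ℓ' + (n : ℤ) • z) → fc f k' = 0) :
    ‖U s t f‖ ≤ Real.sqrt CK * Real.exp (-(cK * ν * (t - s))) * ‖f‖ := by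
  classical
  have hnpos : 0 < n := hn
  have hn0 : (0:ℝ) < n := by exact_mod_cast hnpos
  have hn2 : (0:ℝ) < 1 / (n:ℝ) ^ 2 := by positivity
  have hL0 : 0 < Tw - s := by linarith
  -- lam-free window of the cell tensor
  have hAΛ : NearIso 𝔸 (ν * (lo / Λ)) (ν * (hi * Λ)) := by
    obtain ⟨lam, hlam, hA⟩ := hwin
    have hlam1 : 0 < lam := lt_of_lt_of_le one_pos hlam.1
    exact hA.mono (mul_le_mul_of_nonneg_left (div_le_div_of_nonneg_left hlo.le hlam1 hlam.2) hν.1.le)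
      (mul_le_mul_of_nonneg_left (mul_le_mul_of_nonneg_left hlam.2 hhi) hν.1.le)
  have hN : NearIso ((1 / (n:ℝ) ^ 2) • 𝔸) ((1 / (n:ℝ) ^ 2) * (ν * (lo / Λ))) ((1 / (n:ℝ) ^ 2) * (ν * (hi * Λ))) := hAΛ.smul hn2.le
  have hloU : 0 < (1 / (n:ℝ) ^ 2) * (ν * (lo / Λ)) := by
    have hΛ0 : 0 < Λ := lt_of_lt_of_le one_pos hΛ
    have hν0 : 0 < ν := hν.1
    positivity
  set W₁ : LatticeWord k := (W.stretch M hM).stretch (1 / ν) (one_div_pos.mpr hν.1) with hW₁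
  have hU' : IsPropagator Tw (W₁.cell n) ((1 / (n:ℝ) ^ 2) • 𝔸) U := hU
  have hphase' : ∀ τ, W₁.cell n (s + τ) = W₁.cell n τ := hphase
  have hfdiv : FunctionSpaces.Torus.IsWeaklyDivFree (f : VF) := (mem_divFreeL2_iff f).1 hf
  have hfi : Integrable (f : VF) volume := (Lp.memLp f).integrable one_le_two
  set e : ℝ := Real.sqrt CK * Real.exp (-(cK * ν * (t - s))) with he
  have he0 : 0 ≤ e := by positivity
  -- STEP 1: the bound for every truncation
  have key : ∀ N : ℕ, ‖U s t (((Torus.isSmooth_fourierTruncate N (f : VF)).memLp 2).toLp (Torus.fourierTruncate N (f : VF)))‖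
      ≤ e * ‖f‖ := by
    intro N
    set F : VF := Torus.fourierTruncate N (f : VF) with hF
    have hFsm : Torus.IsSmooth F := Torus.isSmooth_fourierTruncate N (f : VF)
    have hF2 : MemLp F 2 volume := hFsm.memLp 2
    have hFi : Integrable F volume := hF2.integrable one_le_two
    set v : V2 := hF2.toLp F with hv
    have hFv : (F : VF) =ᵐ[volume] ⇑v := (MemLp.coeFn_toLp hF2).symm
    have hFdf : Torus.IsDivFree F := Torus.isDivFree_fourierTruncate (Lp.memLp f) hfdiv N
    have hFdiv : FunctionSpaces.Torus.IsWeaklyDivFree F := hFdf.isWeaklyDivFree_holds hFsm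
    have hvdiv : FunctionSpaces.Torus.IsWeaklyDivFree (v : VF) := hFdiv.congr_ae hFv
    obtain ⟨u, E, Q, hu, -, -, hEc, -, -, hEae, -, -, hUE⟩ := exists_sol_modeRep_energy W₁ n hN hloU hU' hs hsT hphase' v hvdiv
    have hcoef : ∀ k', mFourierCoeff (FunctionSpaces.EuclideanSpace.complexify ∘ F) k' = if k' ∈ Torus.freqBall N then fc f k' else 0 :=
      fun k' => Torus.mFourierCoeff_fourierTruncate hfi N k'
    have h00 : fc f 0 = 0 := hfs 0 ⟨0, 0, by rw [Torus.latticeVec_zero, norm_zero]; exact hL, by simp⟩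
    have hdatum : IsDatum F := by
      refine ⟨hFsm.memSobolev_one_complexify, ?_, hFdiv⟩
      refine hasZeroMean_of_mFourierCoeff_zero ?_
      rw [hcoef]
      split_ifs
      · exact h00
      · rfl
    have hlab : ∀ k' : Fin 3 → ℤ, (∃ ℓ' z : Fin 3 → ℤ, ‖Torus.latticeVec ℓ'‖ < L ∧ k' = ℓ' + (n : ℤ) • z) →
        ∀ i, modeCoeff k' F i = 0 := by
      intro k' hk' i
      rw [modeCoeff_eq hFi, hcoef]
      split_ifs
      · rw [hfs k' hk']; rfl
      · rfl
    have hu' : IsWeakTensorPassiveVectorOn 0 (Tw - s) ((1 / (n:ℝ) ^ 2) • 𝔸) (cellField W M hM ν hν.1 n) F u := hu.congr_datum hFv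
    have hdecay := hH ν hν n hn 𝔸 hodd hwin L hL hKL F hdatum hlab (Tw - s) hL0 u hu'
    have hFnorm : ∫ x, ‖F x‖ ^ 2 = ‖v‖ ^ 2 := by
      rw [OneLevelSplit.norm_sq_eq_integral]
      exact integral_congr_ae (hFv.mono fun x hx => by simp only [hx])
    set G : ℝ → ℝ := fun τ => CK * Real.exp (-(2 * cK * ν * τ)) * ‖v‖ ^ 2 with hG
    have hae : ∀ᵐ τ ∂(volume.restrict (Ioo 0 (Tw - s))), E τ ≤ G τ := by
      filter_upwards [hdecay, hEae] with τ hτ hEτ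
      rw [hEτ, hG]; dsimp only; rw [← hFnorm]; exact hτ
    have hGc : ContinuousOn G (Icc 0 (Tw - s)) :=
      ((continuous_const.mul (Real.continuous_exp.comp (continuous_const.mul continuous_id).neg)).mul continuous_const).continuousOn
    have hall := le_on_Icc_of_ae_le hL0 hEc hGc hae
    have hτ : t - s ∈ Icc 0 (Tw - s) := ⟨by linarith, by linarith⟩
    have est : s + (t - s) = t := by ring
    have h1 : ‖U s t v‖ ^ 2 ≤ G (t - s) := by
      have h := hUE (t - s) hτ
      rw [est] at h
      exact h.trans (hall (t - s) hτ)
    have h2 : G (t - s) = (e * ‖v‖) ^ 2 := by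
      rw [hG, he]; dsimp only
      rw [mul_pow, mul_pow, Real.sq_sqrt hCK, ← Real.exp_nat_mul]
      congr 2; push_cast; ring
    rw [h2] at h1
    have h3 : ‖U s t v‖ ≤ e * ‖v‖ := (pow_le_pow_iff_left₀ (norm_nonneg _) (by positivity) two_ne_zero).1 h1
    -- `‖v‖ ≤ ‖f‖` (Bessel)
    have hvf : ‖v‖ ≤ ‖f‖ := by
      have h4 : ‖v‖ ^ 2 ≤ ‖f‖ ^ 2 := by
        rw [← hFnorm, OneLevelSplit.norm_sq_eq_integral]
        exact Torus.integral_norm_sq_fourierTruncate_le (Lp.memLp f) N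
      exact (pow_le_pow_iff_left₀ (norm_nonneg _) (norm_nonneg _) two_ne_zero).1 h4
    exact h3.trans (mul_le_mul_of_nonneg_left hvf he0)
  -- STEP 2: `N → ∞`
  have hlim : Tendsto (fun N : ℕ => e * ‖f‖ + ‖U s t‖ *
      ‖f - ((Torus.isSmooth_fourierTruncate N (f : VF)).memLp 2).toLp (Torus.fourierTruncate N (f : VF))‖) atTop
      (𝓝 (e * ‖f‖)) := by
    have h := (tendsto_const_nhds (x := e * ‖f‖)).add
      ((tendsto_const_nhds (x := ‖U s t‖)).mul (tendsto_norm_sub_toLp_fourierTruncate f))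
    rwa [mul_zero, add_zero] at h
  refine ge_of_tendsto' hlim fun N => ?_
  set v : V2 := ((Torus.isSmooth_fourierTruncate N (f : VF)).memLp 2).toLp (Torus.fourierTruncate N (f : VF)) with hv
  have hsplit : U s t f = U s t v + U s t (f - v) := by rw [← map_add, add_sub_cancel]
  calc ‖U s t f‖ = ‖U s t v + U s t (f - v)‖ := by rw [hsplit]
    _ ≤ ‖U s t v‖ + ‖U s t (f - v)‖ := norm_add_le _ _
    _ ≤ e * ‖f‖ + ‖U s t‖ * ‖f - v‖ := add_le_add (key N) ((U s t).le_opNorm _)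

end Summit.AnomalousDissipation.AnomalousDissipation.Theorems.SolenoidalFractalHomogenisation.LagrangianStep.VmodGen

end
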